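import Summits.KontsevichZagierPeriods.KontsevichZagierPeriods.Theses.ToricCore
import Literature.NumberTheory.Transcendental.KZToricCalculus

/-!
# `ToricKernel` (stmt-KontsevichZagierPeriods-7833, route ToricCore) — birth skeleton

Crux (verbatim the route decl `…Theses.ToricCore.ToricKernel`, the route's target, auto-promoted to
crux as an underived hypothesis of `closes`): Conjecture 1 on the TORIC SPAN in kernel form —
`∀ c ∈ T, KZ.eval c = 0 → c ∈ KZ.relations`, where `T` is the subgroup of `KZ.FormalRep` generated
by the classes `[r]` of toric representations (domain a signed-binomial cell
`{x | ∀ k, 0 < g_k x} ∩ {x | ∀ k, 0 ≤ h_k x}`, integrand `P(x)/∏_k d_k(x)` on it, `P ∈ ℚ[x₁,…,xₙ]`,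
every `g_k, h_k, d_k` a signed binomial `u·xᵃ + w·xᵇ`). The inline `let T := …` of the route file is,
token for token, the Literature constant `Literature.NumberTheory.Transcendental.KZ.toricSpan`
(`KZToricCalculus.lean`), so the crux restates as
`∀ c ∈ KZ.toricSpan, KZ.eval c = 0 → c ∈ KZ.relations` by `Iff.rfl` (`toricKernel_iff` below).

## Line "birth": resolve the fan, then decide the kernel on smooth cones

The period-conjecture strength of the crux lives on the VALUES (conical zeta values of all
cyclotomic levels); the geometry of the cells does not carry any of it. The line peels the
geometry off by the two transcendence-free moves the route imports from toric/polyhedral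
combinatorics (Guo–Paycha–Zhang's cone subdivisions, Terasoma's simplicial cones), and leaves a
kernel statement on ONE normal form — Laurent-binomial integrands on open unit cubes:

* `stub_fanDecomposition` (S1, ACCESSIBILITY OF SIMPLICIAL CELLS; transcendence-free, size L):
  every `c ∈ T` is congruent modulo `KZ.relations` to an element of the SIMPLICIAL SPAN `S` — the
  subgroup generated by the classes of representations whose domain is a simplicial cell
  `Φ_A(□ⁿ)`, `Φ_A(y) = (∏_j y_j^{A i j})_i`, `A ∈ Mₙ(ℤ)`, `det A ≠ 0`, `□ⁿ = {y | ∀ i, 0 < y_i < 1}`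
  (in logarithmic coordinates: the open simplicial rational cone spanned by the columns of `−A`),
  and whose integrand is, on it, `P/∏_k d_k` with `P ∈ ℚ[x]` and signed binomials `d_k`. Intended
  proof, one toric generator `[r]` at a time (closure induction does the rest): cut the cell by the
  coordinate hyperplanes (move 1a; the hyperplanes are null, and a representation with null domain is
  a relation by the `σ = σ ∪ σ` instance of 1a); reflect each orthant piece into the open positive
  orthant by `x ↦ (ε_i x_i)_i` (move 2, `|det| = 1`; signed binomials go to signed binomials, the
  signs `u ε^a` staying in `{−1, 0, 1}`); there the cell is, up to a null set, `exp` of a rational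
  polyhedral cone (`u xᵃ + w xᵇ > 0` is trivial, empty, or the half-space `⟨a − b, log x⟩ ≷ 0`),
  which is either of lower dimension (null: a relation) or — after the cuts `x_i ≷ 1` that make its
  pieces pointed — triangulated by finitely many simplicial rational cones `σ = cone(w₁,…,wₙ)`; the
  cuts along the walls `x^{m⁺} = x^{m⁻}` are semialgebraic and null (move 1a), and
  `exp(σ°) = Φ_A(□ⁿ)` for `A j i = −(w_i)_j`. Why it might fail: only by a defect of
  the inline encoding (restrictions of an `IntegralRep` to semialgebraic pieces are `IntegralRep`s:
  `KZ.IntegralRep.restrict`); the polyhedral input — every rational polyhedral cone is a finite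
  union of simplicial rational cones meeting along null walls — is elementary but not in Mathlib.
* `stub_monomialChart` (S2, THE MONOMIAL CHART; transcendence-free, size M): every element of the
  simplicial span `S` is congruent modulo `KZ.relations` to an element of the CUBE SPAN `Q` — the
  subgroup generated by the classes of representations with domain `□ⁿ` itself and integrand
  `P/∏_k d_k` on it (`P ∈ ℚ[y]`, `d_k` signed binomials). Intended proof, one generator at a time:
  pull `r` back along `Φ_A : □ⁿ → Φ_A(□ⁿ)`; this is ONE instance of move (2)
  (`KZ.changeOfVariablesRel`): `Φ_A` is `ℚ`-semialgebraic (Laurent monomials), differentiable and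
  injective on the open positive orthant when `det A ≠ 0`, with
  `|det DΦ_A(y)| = |det A| · (∏_i ∏_j y_j^{A i j}) / ∏_j y_j` (the Jacobian the route's `R_tor` uses);
  the pulled-back integrand `(P/∏ d_k)(Φ_A y) · |det DΦ_A(y)|` is a Laurent polynomial over a product
  of Laurent binomials, and clearing the negative exponents by one monomial `y^δ` (a monomial IS a
  signed binomial, `w = 0`) puts it in the shape `P'/∏ d'_k`; absolute integrability is transported
  by the change-of-variables formula for non-negative functions. The route's support items
  `CubicalCoordinates` (the unimodular chart of the ordered simplex) and the monomial clause of
  `ToricSound` are instances of the same computation. Why it might fail: only the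
  `HasFDerivWithinAt`/`InjOn`/semialgebraic-map clauses of `changeOfVariablesRel` for a Laurent
  monomial map, in the exact shape the move demands.
* `stub_cubeKernel` (S3, THE KERNEL ON SMOOTH CONES; conjecture strength — the HARDEST stub, where
  all of the crux's period-conjecture strength now sits): every `q ∈ Q` with `KZ.eval q = 0` lies in
  `KZ.relations` — Conjecture 1 in kernel form for Laurent-binomial integrands on unit cubes, whose
  values are the (alternating, cyclotomic) conical zeta values on SMOOTH cones, i.e. iterated sums
  `Σ_{m ∈ ℕⁿ} ∏(linear forms)^{-1}·(roots of unity)^m` (Guo–Paycha–Zhang 2014; Terasoma,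
  arXiv:math/0410306: cyclotomic multiple zeta values). This is the statement the route's toric
  engine is FOR: its ranked cruxes `DualityWeightThreeToric`, `HoffmanWeightFourToric` and the
  support `TornheimToric` sharpen particular instances of it (membership in `R_tor ⊆ KZ.relations`
  rather than in `KZ.relations`; `Z₃, Z₂₁, S, U, Z₄, Z₃₁, Z₂₂` are cube representations on the
  literal cube `{x | ∀ i, 0 < x i ∧ x i < 1}` used below). Why it might fail: exactly the crux's own
  why-might-fail — false as soon as the
  four moves miss one motivic relation among cyclotomic conical zeta values
  (HuberMullerStach2017 Rem. 13.1.8) or a non-motivic `ℤ`-relation among them exists; the strength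
  barriers `Literature.Barriers.KontsevichZagierPeriods.kzConjecture_implies_oddZetaAlgIndep` /
  `kzConjecture_implies_twoPiI_log_algIndep` bite here precisely as they bite on the crux
  (`π = ∫_□¹ 4 dy/(1 + y²)`, `log 2 = ∫_□¹ dy/(1 + y)`, `ζ(s) = ∫_□ˢ dy/(1 − y₁⋯y_s)` are values of
  cube representations) — conceded, not evaded: S1 and S2 only relocate the strength onto a normal
  form.

Composition `ToricKernel_of : S1-sig → S2-sig → S3-sig → ToricKernel` is sorry-free and short
(given `c ∈ T` with `eval c = 0`: S1 gives `t ∈ S` with `c − t ∈ KZ.relations`, S2 gives `q ∈ Q`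
with `t − q ∈ KZ.relations`, soundness `KZ.relations_le_ker_eval_holds` gives `eval q = 0`, S3 gives
`q ∈ KZ.relations`, and `c = (c − t) + (t − q) + q`); `toricKernel_skeleton : ToricKernel` feeds the
three stubs in. The barrier `Literature.Barriers.KontsevichZagierPeriods.noSemialgebraicPrimitive_inv_sub_two`
is not engaged: S1 and S2 use moves (1a) and (2) only — no primitive is ever taken.

Disproof used: none on file — `ledger crux ls stmt-KontsevichZagierPeriods-7833` lists no
`Disproof.lean`, no `Lines/*`, no dead lines; no landed `Theorems/ToricKernel/Negative/*`; the
negatives index of the summit has one unrelated entry (KinematicFormulas.KinematicPlaneConvex)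
(2026-08-17). Nearest items elsewhere in the tree: `HermiteRigidity.CubeResolution` /
`SphericalSchlafli.CubeResolution` (accessibility of CLOSED-cube representations with integrands
analytic near the closed cube, for ALL representations — Hironaka/Ayoub shape; S1+S2 here is the
toric special case with boundary-singular Laurent-binomial integrands and needs no resolution of
singularities beyond a triangulation of cones) and `ExponentCosets.MellinAccessibility` (same
accessibility shape for the Mellin span).

BC3 (registrar, 2026-08-17): `lean check --json` rc 0, errors [], sorries 3 = stubs 3 (the three
`stub_*`, zero elsewhere; `ToricKernel_of` axioms [propext, Classical.choice, Quot.sound]); probes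
`stub → ToricKernel` and `stub → KontsevichZagierPeriods`, one `example` per alternative of
`first | exact? | simpa | (unfold; simpa) | aesop` under `set_option maxHeartbeats 400000`, FAIL for
all three stubs (6/6 probe files, 30/30 examples: `exact?` "could not close the goal" or
deterministic time-out — for S1/S2 → crux also at 4 000 000 heartbeats —, `simpa` type mismatch,
`aesop` "failed to prove the goal after exhaustive search"); the informative converse probes
`ToricKernel → stub` fail too. Files `bc/probe_*.lean` in the registrar's folder; outputs in
`Lines/birth.md`.
-/

set_option linter.dupNamespace false

namespace Summit.KontsevichZagierPeriods.KontsevichZagierPeriods.Cruxes.ToricKernel.Birth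

open scoped BigOperators
open Literature.NumberTheory.Transcendental
open Summit.KontsevichZagierPeriods.KontsevichZagierPeriods.Theses.ToricCore (ToricKernel)

/-- The route's inline toric span `let T := AddSubgroup.closure {…}` is, token for token, the
Literature constant `KZ.toricSpan`, so the crux is the kernel statement on `KZ.toricSpan`
(definitional unfolding). [cite: KontsevichZagier2001, §1.2 Conjecture 1] -/
theorem toricKernel_iff :
    ToricKernel ↔ ∀ c ∈ KZ.toricSpan, KZ.eval c = 0 → c ∈ KZ.relations := Iff.rfl

/-- **Stub S1 — fan decomposition (accessibility of the simplicial span; transcendence-free, L).**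
Every element of the toric span is congruent modulo the KZ relations to a `ℤ`-combination of
representations carried by SIMPLICIAL CELLS `Φ_A(□ⁿ) = {(∏_j y_j^{A i j})_i | 0 < y_j < 1}`,
`A ∈ Mₙ(ℤ)`, `det A ≠ 0` (open simplicial rational cones in logarithmic coordinates), with
integrand `P/∏_k d_k` (`P ∈ ℚ[x]`, `d_k` signed binomials) on the cell. Moves used: (1a) along the
coordinate hyperplanes, along `x_i = 1` (pointed pieces) and along the binomial walls
`x^{m⁺} = x^{m⁻}` of a triangulation of the rational polyhedral cone `log(cell ∩ orthant)` (null
walls; null cells are relations by the `σ = σ ∪ σ` instance of (1a)), and (2) for the orthant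
reflections `x ↦ (ε_i x_i)_i` (`|det| = 1`, signed binomials go to signed binomials). Why it might
fail: only through the inline encoding
(restriction of representations to semialgebraic pieces) — the polyhedral input, "a rational
polyhedral cone is a finite union of simplicial rational cones meeting along null walls", is
elementary but absent from Mathlib. [cite: GuoPaychaZhang2014, §2–3 (cones, subdivisions)]
[cite: KontsevichZagier2001, §1.2 rules (1), (2)] -/
theorem stub_fanDecomposition :
    ∀ c ∈ Literature.NumberTheory.Transcendental.KZ.toricSpan,
      ∃ t ∈ AddSubgroup.closure
        {e : Literature.NumberTheory.Transcendental.KZ.FormalRep | ∃ (n K : ℕ)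
          (r : Literature.NumberTheory.Transcendental.KZ.IntegralRep n) (A : Matrix (Fin n) (Fin n) ℤ)
          (d : Fin K → (Fin n → ℝ) → ℝ) (P : MvPolynomial (Fin n) ℚ),
          A.det ≠ 0 ∧
          r.domain = (fun y i => ∏ j, y j ^ A i j) '' {y : Fin n → ℝ | ∀ i, 0 < y i ∧ y i < 1} ∧
          (∀ k, Literature.NumberTheory.Transcendental.KZ.IsSignedBinomial (d k)) ∧
          Set.EqOn r.integrand (fun x => MvPolynomial.aeval x P / ∏ k, d k x) r.domain ∧
          e = Literature.NumberTheory.Transcendental.KZ.of r},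
      c - t ∈ Literature.NumberTheory.Transcendental.KZ.relations := by
  sorry

/-- **Stub S2 — the monomial chart (accessibility of the cube span from the simplicial span;
transcendence-free, M).** Every element of the simplicial span is congruent modulo the KZ
relations to a `ℤ`-combination of CUBE representations: domain the open unit cube
`□ⁿ = {y | ∀ i, 0 < y_i < 1}` itself, integrand `P/∏_k d_k` on it (`P ∈ ℚ[y]`, `d_k` signed
binomials). One instance of move (2) per generator: the monomial map `Φ_A(y) = (∏_j y_j^{A i j})_i`
is `ℚ`-semialgebraic, differentiable and injective on the open positive orthant when `det A ≠ 0`,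
with `|det DΦ_A(y)| = |det A| · (∏_i ∏_j y_j^{A i j}) / ∏_j y_j`; the pulled-back integrand
`(P/∏ d_k)(Φ_A y) · |det DΦ_A(y)|` is a Laurent polynomial over a product of Laurent binomials and
one monomial `y^δ` clears the negative exponents (a monomial is a signed binomial with `w = 0`);
absolute integrability is transported by the change-of-variables formula. The route's
`CubicalCoordinates` (unimodular chart of the ordered simplex) and the monomial clause of
`ToricSound` are instances, and the triangular 0/1-exponent case is landed
(`Summit.KontsevichZagierPeriods.FurushoPentagon.HoffmanRelationInKZ.monomialChart_transport`,
charts `C y i = ∏_{j ∈ S i} y_j`). Why it might fail: only the `HasFDerivWithinAt` / `InjOn` /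
`IsSemialgebraicMapOn` clauses of `KZ.changeOfVariablesRel` for a Laurent monomial map in the exact
shape of the move. [cite: KontsevichZagier2001, §1.2 rule (2)] [cite: GuoPaychaZhang2014, §3 (`GLₙ(ℤ)` on cones)] -/
theorem stub_monomialChart :
    ∀ t ∈ AddSubgroup.closure
        {e : Literature.NumberTheory.Transcendental.KZ.FormalRep | ∃ (n K : ℕ)
          (r : Literature.NumberTheory.Transcendental.KZ.IntegralRep n) (A : Matrix (Fin n) (Fin n) ℤ)
          (d : Fin K → (Fin n → ℝ) → ℝ) (P : MvPolynomial (Fin n) ℚ),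
          A.det ≠ 0 ∧
          r.domain = (fun y i => ∏ j, y j ^ A i j) '' {y : Fin n → ℝ | ∀ i, 0 < y i ∧ y i < 1} ∧
          (∀ k, Literature.NumberTheory.Transcendental.KZ.IsSignedBinomial (d k)) ∧
          Set.EqOn r.integrand (fun x => MvPolynomial.aeval x P / ∏ k, d k x) r.domain ∧
          e = Literature.NumberTheory.Transcendental.KZ.of r},
      ∃ q ∈ AddSubgroup.closure
        {e : Literature.NumberTheory.Transcendental.KZ.FormalRep | ∃ (n K : ℕ)
          (r : Literature.NumberTheory.Transcendental.KZ.IntegralRep n)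
          (d : Fin K → (Fin n → ℝ) → ℝ) (P : MvPolynomial (Fin n) ℚ),
          r.domain = {y : Fin n → ℝ | ∀ i, 0 < y i ∧ y i < 1} ∧
          (∀ k, Literature.NumberTheory.Transcendental.KZ.IsSignedBinomial (d k)) ∧
          Set.EqOn r.integrand (fun x => MvPolynomial.aeval x P / ∏ k, d k x) r.domain ∧
          e = Literature.NumberTheory.Transcendental.KZ.of r},
      t - q ∈ Literature.NumberTheory.Transcendental.KZ.relations := by
  sorry

/-- **Stub S3 — the kernel on smooth cones (conjecture strength; the hardest stub).** Conjecture 1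
in kernel form for the CUBE SPAN: every `ℤ`-combination of cube representations (domain `□ⁿ`,
integrand `P/∏_k d_k` with `P ∈ ℚ[y]` and signed binomials `d_k`) whose value is `0` lies in
`KZ.relations`. Its values are the (alternating, cyclotomic) conical zeta values on smooth cones —
iterated sums over `ℕⁿ` of inverse products of linear forms twisted by roots of unity — so this is
the conical-sector kernel conjecture on its normal form; the route's ranked cruxes
(`DualityWeightThreeToric`, `HoffmanWeightFourToric`) and the support `TornheimToric` sharpen
particular instances of it (membership in the toric sub-calculus `R_tor ⊆ KZ.relations`; their
representations live on the same literal cube). Why it might fail: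
the crux's own risk, undiminished — false as soon as the four moves miss one motivic relation among
cyclotomic conical zeta values (HuberMullerStach2017 Rem. 13.1.8) or a non-motivic `ℤ`-relation
among them exists; the strength barriers `kzConjecture_implies_oddZetaAlgIndep` /
`kzConjecture_implies_twoPiI_log_algIndep` bite here (`ζ(s)`, `π`, `log 2` are cube values:
`∫_□ˢ dy/(1 − y₁⋯y_s)`, `∫_□¹ 4 dy/(1 + y²)`, `∫_□¹ dy/(1 + y)`).
[cite: KontsevichZagier2001, §1.2 Conjecture 1] [cite: GuoPaychaZhang2014, §2 (conical zeta values)]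
[cite: Terasoma2002] -/
theorem stub_cubeKernel :
    ∀ q ∈ AddSubgroup.closure
        {e : Literature.NumberTheory.Transcendental.KZ.FormalRep | ∃ (n K : ℕ)
          (r : Literature.NumberTheory.Transcendental.KZ.IntegralRep n)
          (d : Fin K → (Fin n → ℝ) → ℝ) (P : MvPolynomial (Fin n) ℚ),
          r.domain = {y : Fin n → ℝ | ∀ i, 0 < y i ∧ y i < 1} ∧
          (∀ k, Literature.NumberTheory.Transcendental.KZ.IsSignedBinomial (d k)) ∧
          Set.EqOn r.integrand (fun x => MvPolynomial.aeval x P / ∏ k, d k x) r.domain ∧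
          e = Literature.NumberTheory.Transcendental.KZ.of r},
      Literature.NumberTheory.Transcendental.KZ.eval q = 0 →
        q ∈ Literature.NumberTheory.Transcendental.KZ.relations := by
  sorry

/-- **Composition** (sorry-free): fan decomposition, monomial chart, kernel on the cube span,
chained in the free abelian group `KZ.FormalRep` through the soundness of the calculus
(`KZ.relations_le_ker_eval_holds`): `c = (c − t) + (t − q) + q` with the first two summands
relations, hence `eval q = eval c = 0`. Concludes the route declaration
`…Theses.ToricCore.ToricKernel` by name. [cite: KontsevichZagier2001, §1.2] -/
theorem ToricKernel_of :
    (∀ c ∈ KZ.toricSpan,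
      ∃ t ∈ AddSubgroup.closure
        {e : KZ.FormalRep | ∃ (n K : ℕ) (r : KZ.IntegralRep n) (A : Matrix (Fin n) (Fin n) ℤ)
          (d : Fin K → (Fin n → ℝ) → ℝ) (P : MvPolynomial (Fin n) ℚ),
          A.det ≠ 0 ∧
          r.domain = (fun y i => ∏ j, y j ^ A i j) '' {y : Fin n → ℝ | ∀ i, 0 < y i ∧ y i < 1} ∧
          (∀ k, KZ.IsSignedBinomial (d k)) ∧
          Set.EqOn r.integrand (fun x => MvPolynomial.aeval x P / ∏ k, d k x) r.domain ∧
          e = KZ.of r},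
      c - t ∈ KZ.relations) →
    (∀ t ∈ AddSubgroup.closure
        {e : KZ.FormalRep | ∃ (n K : ℕ) (r : KZ.IntegralRep n) (A : Matrix (Fin n) (Fin n) ℤ)
          (d : Fin K → (Fin n → ℝ) → ℝ) (P : MvPolynomial (Fin n) ℚ),
          A.det ≠ 0 ∧
          r.domain = (fun y i => ∏ j, y j ^ A i j) '' {y : Fin n → ℝ | ∀ i, 0 < y i ∧ y i < 1} ∧
          (∀ k, KZ.IsSignedBinomial (d k)) ∧
          Set.EqOn r.integrand (fun x => MvPolynomial.aeval x P / ∏ k, d k x) r.domain ∧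
          e = KZ.of r},
      ∃ q ∈ AddSubgroup.closure
        {e : KZ.FormalRep | ∃ (n K : ℕ) (r : KZ.IntegralRep n)
          (d : Fin K → (Fin n → ℝ) → ℝ) (P : MvPolynomial (Fin n) ℚ),
          r.domain = {y : Fin n → ℝ | ∀ i, 0 < y i ∧ y i < 1} ∧
          (∀ k, KZ.IsSignedBinomial (d k)) ∧
          Set.EqOn r.integrand (fun x => MvPolynomial.aeval x P / ∏ k, d k x) r.domain ∧
          e = KZ.of r},
      t - q ∈ KZ.relations) →
    (∀ q ∈ AddSubgroup.closure
        {e : KZ.FormalRep | ∃ (n K : ℕ) (r : KZ.IntegralRep n)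
          (d : Fin K → (Fin n → ℝ) → ℝ) (P : MvPolynomial (Fin n) ℚ),
          r.domain = {y : Fin n → ℝ | ∀ i, 0 < y i ∧ y i < 1} ∧
          (∀ k, KZ.IsSignedBinomial (d k)) ∧
          Set.EqOn r.integrand (fun x => MvPolynomial.aeval x P / ∏ k, d k x) r.domain ∧
          e = KZ.of r},
      KZ.eval q = 0 → q ∈ KZ.relations) →
    ToricKernel := by
  intro hfan hchart hker
  rw [toricKernel_iff]
  intro c hc h0
  obtain ⟨t, ht, hct⟩ := hfan c hc
  obtain ⟨q, hq, htq⟩ := hchart t ht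
  -- `c − q = (c − t) + (t − q)` is a relation
  have hcq : c - q ∈ KZ.relations := by
    have h := KZ.relations.add_mem hct htq
    rwa [sub_add_sub_cancel] at h
  -- soundness: relations evaluate to `0`, so `eval q = eval c = 0`
  have h1 : KZ.eval (c - q) = 0 :=
    (AddMonoidHom.mem_ker).mp (KZ.relations_le_ker_eval_holds hcq)
  have hq0 : KZ.eval q = 0 := by
    rwa [map_sub, h0, zero_sub, neg_eq_zero] at h1
  -- the kernel on the cube span, then `c = (c − q) + q`
  have h2 := KZ.relations.add_mem hcq (hker q hq hq0)
  rwa [sub_add_cancel] at h2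

/-- The by-name skeleton theorem: the three stubs fed into `ToricKernel_of` (its only `sorryAx`
dependencies are `stub_fanDecomposition`, `stub_monomialChart`, `stub_cubeKernel`).
[cite: KontsevichZagier2001, §1.2] -/
theorem toricKernel_skeleton : ToricKernel :=
  ToricKernel_of stub_fanDecomposition stub_monomialChart stub_cubeKernel

end Summit.KontsevichZagierPeriods.KontsevichZagierPeriods.Cruxes.ToricKernel.Birth
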